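import Mathlib
import HarnessLib
import Summits.HubbardSuperconductivity.HubbardSuperconductivity.Theorems.KLProgrammeKLRegimeEngineScaleZeroTwoLegGridSums
import Summits.HubbardSuperconductivity.HubbardSuperconductivity.Theorems.KLProgrammeKLRegimeEngineScaleZeroE4Geometry

/-!
# K3 engine (stmt-HubbardSuperconductivity-19918 and its gen-6 successor), stub `stub_twoLeg_scale0`: the three PAIR WEIGHTS of the two-leg
# exports against the grid tree weights, and the off-diagonal / temporal pinned grid sums of `W_N − 𝒩_{K,N}` in the consumers' shapes

Cell gate-hubbard-kl, seat p3 (g7); sequel of `…TwoLegGridSums` (generic-weight bound `twoLeg_offDiag_wsum_le_of_wgridStep`).  The consumers'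
pair weights (`…TwoLegMomentsFromGrid.twoLeg_sep_momentumSizes_of_grid`: OFF-DIAGONAL `[x⃗₁ ≠ x⃗₀]·(1+|Δx̃₀|+|Δx̃₁|)ᵏ`, `k = 1, 2`;
`…TwoLegTimeMomentFromGrid`: the circular grid time distance `(β′/N)·circDist_N(j₀, j₁)`) all VANISH on grid-diagonal pairs and are
dominated by the W-chain's tree weight `wt₁(S) = gridLabelWt L N β′ (S.image gridLegPos) = 1 + diam` (k3c2-p1, `…ScaleZeroE4Defs/Geometry`)
resp. by its degree-`2` sibling `wt₂(S) = (1 + diam)²` (`isTreeWeight_polyDiamWeight`):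

* `natAbs_valMinAbs_sub_le_torusSiteDist` (a centred coordinate difference is at most the periodic `ℓ^∞` distance),
  `gridLabelDist_gridLegPos_le_wt` / `torusSiteDist_le_gridLabelDist_gridLegPos` / `timeDist_le_gridLabelDist_gridLegPos`;
* `offDiagMomentWeight_le_two_mul_wt₁` (`k = 1`, constant `2`), `offDiagMomentWeight_sq_le_four_mul_wt₂` (`k = 2`, constant `4`),
  `timeWeight_le_wt₁` (constant `1`); the diagonal vanishing `offDiagMomentWeight_eq_zero_of_point_eq`, `timeWeight_eq_zero_of_point_eq`;
* `isTreeWeight_wt₁` / `isTreeWeight_wt₂` (pull-backs along `gridLegPos`);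
* **`twoLeg_offDiag_moment_one_sum_le`**, **`twoLeg_offDiag_moment_two_sum_le`**, **`twoLeg_time_sum_le`** — the point-indexed sums of the
  consumers, `Σ_{p₁} ω(p₀,p₁)·‖kernel₂ (W − 𝒩_{K,N}) ((p₀,σ,+),(p₁,σ,−))‖ ≤ c·ρ⁻²·e‖Ṽ‖_{h,wt}·θ_w/(1−θ_w)`, `c = 2, 4, 1`, modulo the
  `wt`-weighted covariance sizes `α_w` (row/column sums of `‖C X Y‖·wt{X,Y}`; for `wt₁` this is the (E4)₀ lane's `α_w`, for `wt₂` a SECOND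
  space–time moment of the covariance — a new supplier input) and the `wt`-weighted pinned profile of `Ṽ` (for `wt₁`:
  `sum_norm_kernel_gridVertex_mul_wt_le`, k3c2-p1; for `wt₂`: hypothesis).

Everything is PROVED; no definitions; nothing about the model is asserted.  References: BGM 2006 §3 (3.2)–(3.8) [cite: BenfattoGiulianiMastropietro2006].
-/

noncomputable section

namespace Summit.HubbardSuperconductivity.HubbardSuperconductivity.Theorems.EngineV8

set_option linter.dupNamespace false -- summit = problem name (single-conjunct summit), D-0017

open Real Finset Literature.MathematicalPhysics.QuantumLattice Literature.Probability.LatticeModels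
open Literature.Probability.LatticeModels.BattleFederbush GrassmannAlgebra
open Summit.HubbardSuperconductivity.HubbardSuperconductivity.Theorems.KLRegimeSplit

variable {L N : ℕ} [NeZero L] [NeZero N]

/-! ## §1 Coordinate differences, the torus distance, the grid distance of the two legs -/

omit [NeZero N] in
/-- **A centred coordinate difference is at most the periodic `ℓ^∞` distance**: `|((y − x) i)~| ≤ torusSiteDist x y`. -/
theorem natAbs_valMinAbs_sub_le_torusSiteDist (x y : TorusSite 2 L) (i : Fin 2) :
    ((((y - x) i).valMinAbs.natAbs : ℕ) : ℝ) ≤ torusSiteDist x y := by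
  have key : ((y - x) i).valMinAbs.natAbs = circDist L (x i).val (y i).val := by
    rw [circDist_val_eq, Pi.sub_apply, ZMod.valMinAbs_natAbs_eq_min]
    by_cases h : y i - x i = 0
    · have h' : x i - y i = 0 := by rw [← neg_sub, h, neg_zero]
      rw [h, h', ZMod.val_zero]
      simp
    · haveI : NeZero (y i - x i) := ⟨h⟩
      rw [show x i - y i = -(y i - x i) by ring, ZMod.val_neg_of_ne_zero, min_comm]
  rw [torusSiteDist_eq_max_circDist, key]
  fin_cases i
  · exact le_max_left _ _
  · exact le_max_right _ _

omit [NeZero L] [NeZero N] in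
/-- **The grid distance of the two legs is dominated by the weight of their position set**:
`gridLabelDist (pos Y₀) (pos Y₁) ≤ gridLabelWt ((image Y).image gridLegPos) − 1`. -/
theorem gridLabelDist_gridLegPos_le_wt_sub_one (β' : ℝ) (Y : Fin 2 → GridLeg (GridPoint L N)) :
    gridLabelDist L N β' (gridLegPos (Y 0)) (gridLegPos (Y 1)) ≤ gridLabelWt L N β' ((univ.image Y).image gridLegPos) - 1 := by
  rw [Finset.image_image]
  exact gridLabelDist_le_gridLabelWt_image_sub_one L N β' (gridLegPos ∘ Y) 0 1

omit [NeZero L] in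
/-- The spatial part: `torusSiteDist x⃗₀ x⃗₁ ≤ gridLabelDist (pos Y₀) (pos Y₁)` (`β′ ≥ 0`). -/
theorem torusSiteDist_le_gridLabelDist_gridLegPos {β' : ℝ} (hβ' : 0 ≤ β') (Y : Fin 2 → GridLeg (GridPoint L N)) :
    torusSiteDist (Y 0).1.1.2 (Y 1).1.1.2 ≤ gridLabelDist L N β' (gridLegPos (Y 0)) (gridLegPos (Y 1)) := by
  rw [gridLabelDist_apply, gridLegPos_apply, gridLegPos_apply]
  exact le_add_of_nonneg_left (mul_nonneg (div_nonneg hβ' (Nat.cast_nonneg _)) ((isLabelDist_cyclicDist N).nonneg _ _))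

omit [NeZero L] in
/-- The temporal part: `(β′/N)·circDist_N(j₀, j₁) ≤ gridLabelDist (pos Y₀) (pos Y₁)`. -/
theorem timeDist_le_gridLabelDist_gridLegPos (β' : ℝ) (Y : Fin 2 → GridLeg (GridPoint L N)) :
    β' / N * (circDist N (Y 0).1.1.1.val (Y 1).1.1.1.val : ℝ) ≤ gridLabelDist L N β' (gridLegPos (Y 0)) (gridLegPos (Y 1)) := by
  rw [gridLabelDist_apply, gridLegPos_apply, gridLegPos_apply, circDist_eq_cyclicDist]
  exact le_add_of_nonneg_right (Nat.cast_nonneg _)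

/-! ## §2 The three pair weights: diagonal vanishing and domination -/

/-- **The off-diagonal first-moment weight is dominated by twice the pair weight**:
`[x⃗₁ ≠ x⃗₀]·(1 + |Δx̃₀| + |Δx̃₁|) ≤ 2·gridLabelWt ((image Y).image gridLegPos)` (`β′ ≥ 0`). -/
theorem offDiagMomentWeight_le_two_mul_wt₁ {β' : ℝ} (hβ' : 0 ≤ β') (Y : Fin 2 → GridLeg (GridPoint L N)) :
    (if (Y 1).1.1.2 - (Y 0).1.1.2 = 0 then (0 : ℝ) else
      (1 + ((((Y 1).1.1.2 - (Y 0).1.1.2) 0).valMinAbs.natAbs : ℝ) + ((((Y 1).1.1.2 - (Y 0).1.1.2) 1).valMinAbs.natAbs : ℝ))) ≤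
      2 * gridLabelWt L N β' ((univ.image Y).image gridLegPos) := by
  have h0 := natAbs_valMinAbs_sub_le_torusSiteDist (Y 0).1.1.2 (Y 1).1.1.2 0
  have h1 := natAbs_valMinAbs_sub_le_torusSiteDist (Y 0).1.1.2 (Y 1).1.1.2 1
  have hd := (torusSiteDist_le_gridLabelDist_gridLegPos hβ' Y).trans (gridLabelDist_gridLegPos_le_wt_sub_one β' Y)
  have hw := one_le_gridLabelWt L N β' ((univ.image Y).image gridLegPos)
  split_ifs
  · linarith
  · linarith

/-- **The off-diagonal second-moment weight is dominated by four times the squared pair weight**: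
`[x⃗₁ ≠ x⃗₀]·(1 + |Δx̃₀| + |Δx̃₁|)² ≤ 4·(1 + diam)²` (`β′ ≥ 0`). -/
theorem offDiagMomentWeight_sq_le_four_mul_wt₂ {β' : ℝ} (hβ' : 0 ≤ β') (Y : Fin 2 → GridLeg (GridPoint L N)) :
    (if (Y 1).1.1.2 - (Y 0).1.1.2 = 0 then (0 : ℝ) else
      (1 + ((((Y 1).1.1.2 - (Y 0).1.1.2) 0).valMinAbs.natAbs : ℝ) + ((((Y 1).1.1.2 - (Y 0).1.1.2) 1).valMinAbs.natAbs : ℝ)) ^ 2) ≤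
      4 * diamWeight (fun s => (1 + 1 * s) ^ 2) (gridLabelDist L N β') ((univ.image Y).image gridLegPos) := by
  have h0 := natAbs_valMinAbs_sub_le_torusSiteDist (Y 0).1.1.2 (Y 1).1.1.2 0
  have h1 := natAbs_valMinAbs_sub_le_torusSiteDist (Y 0).1.1.2 (Y 1).1.1.2 1
  have hd : torusSiteDist (Y 0).1.1.2 (Y 1).1.1.2 ≤ labelDiam (gridLabelDist L N β') ((univ.image Y).image gridLegPos) := by
    refine (torusSiteDist_le_gridLabelDist_gridLegPos hβ' Y).trans ?_
    rw [Finset.image_image]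
    exact le_labelDiam _ (mem_image_of_mem _ (mem_univ 0)) (mem_image_of_mem _ (mem_univ 1))
  have hD0 : 0 ≤ labelDiam (gridLabelDist L N β') ((univ.image Y).image gridLegPos) := labelDiam_nonneg _ _
  have ha0 : (0 : ℝ) ≤ ((((Y 1).1.1.2 - (Y 0).1.1.2) 0).valMinAbs.natAbs : ℝ) := Nat.cast_nonneg _
  have ha1 : (0 : ℝ) ≤ ((((Y 1).1.1.2 - (Y 0).1.1.2) 1).valMinAbs.natAbs : ℝ) := Nat.cast_nonneg _
  rw [diamWeight, one_mul]
  split_ifs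
  · positivity
  · nlinarith

omit [NeZero L] in
/-- **The circular grid time distance is dominated by the pair weight**: `(β′/N)·circDist_N(j₀, j₁) ≤ gridLabelWt ((image Y).image gridLegPos)`. -/
theorem timeWeight_le_wt₁ (β' : ℝ) (Y : Fin 2 → GridLeg (GridPoint L N)) :
    β' / N * (circDist N (Y 0).1.1.1.val (Y 1).1.1.1.val : ℝ) ≤ gridLabelWt L N β' ((univ.image Y).image gridLegPos) := by
  have h := (timeDist_le_gridLabelDist_gridLegPos β' Y).trans (gridLabelDist_gridLegPos_le_wt_sub_one β' Y)
  linarith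

omit [NeZero L] [NeZero N] in
/-- The off-diagonal moment weights vanish when both legs sit at one grid point (any exponent). -/
theorem offDiagMomentWeight_eq_zero_of_point_eq (k : ℕ) (Y : Fin 2 → GridLeg (GridPoint L N)) (hY : (Y 0).1.1 = (Y 1).1.1) :
    (if (Y 1).1.1.2 - (Y 0).1.1.2 = 0 then (0 : ℝ) else
      (1 + ((((Y 1).1.1.2 - (Y 0).1.1.2) 0).valMinAbs.natAbs : ℝ) + ((((Y 1).1.1.2 - (Y 0).1.1.2) 1).valMinAbs.natAbs : ℝ)) ^ k) = 0 := by
  rw [if_pos]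
  rw [show (Y 1).1.1.2 = (Y 0).1.1.2 from (congrArg Prod.snd hY).symm, sub_self]

omit [NeZero L] in
/-- The circular grid time distance vanishes when both legs sit at one grid point. -/
theorem timeWeight_eq_zero_of_point_eq (β' : ℝ) (Y : Fin 2 → GridLeg (GridPoint L N)) (hY : (Y 0).1.1 = (Y 1).1.1) :
    β' / N * (circDist N (Y 0).1.1.1.val (Y 1).1.1.1.val : ℝ) = 0 := by
  rw [show (Y 1).1.1.1 = (Y 0).1.1.1 from (congrArg Prod.fst hY).symm, circDist_eq_cyclicDist,
    (isLabelDist_cyclicDist N).self, mul_zero]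

/-! ## §3 The two tree weights on the grid legs -/

/-- `wt₁(S) = gridLabelWt (S.image gridLegPos)` is a tree weight (`β′ ≥ 0`). -/
theorem isTreeWeight_wt₁ {β' : ℝ} (hβ' : 0 ≤ β') :
    IsTreeWeight (fun S : Finset (GridLeg (GridPoint L N)) => gridLabelWt L N β' (S.image gridLegPos)) :=
  (isTreeWeight_gridLabelWt L N hβ').comap gridLegPos

/-- `wt₂(S) = (1 + diam (S.image gridLegPos))²` is a tree weight (`β′ ≥ 0`). -/
theorem isTreeWeight_wt₂ {β' : ℝ} (hβ' : 0 ≤ β') :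
    IsTreeWeight (fun S : Finset (GridLeg (GridPoint L N)) =>
      diamWeight (fun s => (1 + 1 * s) ^ 2) (gridLabelDist L N β') (S.image gridLegPos)) :=
  (isTreeWeight_polyDiamWeight (isLabelDist_gridLabelDist L N hβ') zero_le_one 2).comap gridLegPos

/-! ## §4 The consumers' point sums of `kernel₂ (W − 𝒩_{K,N})` -/

/-- **THE OFF-DIAGONAL FIRST SPATIAL MOMENT** (`B₁`): with `wt₁`, its weighted covariance sizes `α_w` and weighted vertex profile `N_w`
(`sum_norm_kernel_gridVertex_mul_wt_le` supplies it), `θ_w < 1`: for every spin `σ` and grid point `p₀`,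
`Σ_{p₁} [x⃗₁ ≠ x⃗₀](1+|Δx̃₀|+|Δx̃₁|)·‖kernel₂ (W − 𝒩_{K,N}) ((p₀,σ,+),(p₁,σ,−))‖ ≤ 2·ρ⁻²·e‖Ṽ‖_{h,wt₁}·θ_w/(1−θ_w)`. -/
theorem twoLeg_offDiag_moment_one_sum_le (C : Matrix (GridLeg (GridPoint L N)) (GridLeg (GridPoint L N)) ℂ) (β U : ℝ) (K : TrigPolyC4v)
    {β' : ℝ} (hβ' : 0 ≤ β') {κ : ℝ} (hκ : 0 < κ) (hGB : IsGramBoundedR C κ) (Nw : ℕ → ℝ) (hNw0 : ∀ m', 0 ≤ Nw m')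
    (hNw : ∀ m' (j : Fin (2 * m')) (w : GridLeg (GridPoint L N)),
      ∑ Y ∈ univ.filter (fun Y : Fin (2 * m') → GridLeg (GridPoint L N) => Y j = w),
        ‖kernel ℂ (hubbardGridInteraction L N β U + hubbardGridCounterQuadratic L N β K) (2 * m') Y‖ *
          gridLabelWt L N β' ((univ.image Y).image gridLegPos) ≤ Nw m')
    {αw : ℝ} (hαw : 0 < αw) (hrow : ∀ X, ∑ Y, ‖C X Y‖ * gridLabelWt L N β' {gridLegPos X, gridLegPos Y} ≤ αw)
    (hcol : ∀ Y, ∑ X, ‖C X Y‖ * gridLabelWt L N β' {gridLegPos X, gridLegPos Y} ≤ αw)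
    {ρ : ℝ} (hρ : 0 < ρ) (hθ : Real.exp 1 * αw * normV (GridLeg (GridPoint L N)) κ ρ Nw / κ ^ 2 < 1)
    (σ : Fin 2) (p₀ : GridPoint L N) :
    ∑ p₁ : GridPoint L N, (if p₁.2 - p₀.2 = 0 then (0 : ℝ) else
        (1 + (((p₁.2 - p₀.2) 0).valMinAbs.natAbs : ℝ) + (((p₁.2 - p₀.2) 1).valMinAbs.natAbs : ℝ))) *
      ‖kernel ℂ (effAction ℂ C (hubbardGridInteraction L N β U + hubbardGridCounterQuadratic L N β K) -
          hubbardGridCounterQuadratic L N β K) 2 (fun i => ((![p₀, p₁] i, σ), i))‖ ≤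
      2 * (ρ⁻¹ ^ 2 * (Real.exp 1 * normV (GridLeg (GridPoint L N)) κ ρ Nw) *
        (Real.exp 1 * αw * normV (GridLeg (GridPoint L N)) κ ρ Nw / κ ^ 2) /
          (1 - Real.exp 1 * αw * normV (GridLeg (GridPoint L N)) κ ρ Nw / κ ^ 2)) := by
  set ω : (Fin 2 → GridLeg (GridPoint L N)) → ℝ := fun Y => if (Y 1).1.1.2 - (Y 0).1.1.2 = 0 then (0 : ℝ) else
      (1 + ((((Y 1).1.1.2 - (Y 0).1.1.2) 0).valMinAbs.natAbs : ℝ) + ((((Y 1).1.1.2 - (Y 0).1.1.2) 1).valMinAbs.natAbs : ℝ)) with hω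
  have hω0 : ∀ Y, 0 ≤ ω Y := fun Y => by rw [hω]; dsimp only; split_ifs <;> positivity
  have hpair : ∀ X Y : GridLeg (GridPoint L N), ({X, Y} : Finset (GridLeg (GridPoint L N))).image gridLegPos = {gridLegPos X, gridLegPos Y} :=
    fun X Y => by rw [image_insert, image_singleton]
  have h := twoLeg_offDiag_wsum_le_of_wgridStep C β U K (isTreeWeight_wt₁ (L := L) (N := N) hβ') hκ hGB Nw hNw0
    (fun m' j w => by simpa only [Finset.image_image] using hNw m' j w) hαw (fun X => by simpa only [hpair] using hrow X)
    (fun Y => by simpa only [hpair] using hcol Y) hρ hθ ω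
    (fun Y hY => by simpa only [hω, pow_one] using offDiagMomentWeight_eq_zero_of_point_eq 1 Y hY) zero_le_two
    (fun Y => by simpa only [hω, Finset.image_image] using offDiagMomentWeight_le_two_mul_wt₁ (L := L) (N := N) hβ' Y) (((p₀, σ), 0))
  refine le_trans ?_ h
  refine le_trans (le_of_eq ?_) (sum_point_string_le_sum_pinned (fun Y => ω Y * ‖kernel ℂ (effAction ℂ C
      (hubbardGridInteraction L N β U + hubbardGridCounterQuadratic L N β K) - hubbardGridCounterQuadratic L N β K) 2 Y‖)
      (fun Y => mul_nonneg (hω0 Y) (norm_nonneg _)) σ p₀)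
  refine sum_congr rfl fun p₁ _ => ?_
  simp only [hω, Matrix.cons_val_zero, Matrix.cons_val_one, Matrix.cons_val_fin_one]

/-- **THE OFF-DIAGONAL SECOND SPATIAL MOMENT** (`B₂`): with `wt₂ = (1 + diam)²`, its weighted covariance sizes `α_{w²}` (a second space–time
moment of the covariance) and weighted vertex profile `N_{w²}`, `θ_{w²} < 1`:
`Σ_{p₁} [x⃗₁ ≠ x⃗₀](1+|Δx̃₀|+|Δx̃₁|)²·‖kernel₂ (W − 𝒩_{K,N}) ((p₀,σ,+),(p₁,σ,−))‖ ≤ 4·ρ⁻²·e‖Ṽ‖_{h,wt₂}·θ/(1−θ)`. -/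
theorem twoLeg_offDiag_moment_two_sum_le (C : Matrix (GridLeg (GridPoint L N)) (GridLeg (GridPoint L N)) ℂ) (β U : ℝ) (K : TrigPolyC4v)
    {β' : ℝ} (hβ' : 0 ≤ β') {κ : ℝ} (hκ : 0 < κ) (hGB : IsGramBoundedR C κ) (Nw : ℕ → ℝ) (hNw0 : ∀ m', 0 ≤ Nw m')
    (hNw : ∀ m' (j : Fin (2 * m')) (w : GridLeg (GridPoint L N)),
      ∑ Y ∈ univ.filter (fun Y : Fin (2 * m') → GridLeg (GridPoint L N) => Y j = w),
        ‖kernel ℂ (hubbardGridInteraction L N β U + hubbardGridCounterQuadratic L N β K) (2 * m') Y‖ *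
          diamWeight (fun s => (1 + 1 * s) ^ 2) (gridLabelDist L N β') ((univ.image Y).image gridLegPos) ≤ Nw m')
    {αw : ℝ} (hαw : 0 < αw)
    (hrow : ∀ X, ∑ Y, ‖C X Y‖ * diamWeight (fun s => (1 + 1 * s) ^ 2) (gridLabelDist L N β') {gridLegPos X, gridLegPos Y} ≤ αw)
    (hcol : ∀ Y, ∑ X, ‖C X Y‖ * diamWeight (fun s => (1 + 1 * s) ^ 2) (gridLabelDist L N β') {gridLegPos X, gridLegPos Y} ≤ αw)
    {ρ : ℝ} (hρ : 0 < ρ) (hθ : Real.exp 1 * αw * normV (GridLeg (GridPoint L N)) κ ρ Nw / κ ^ 2 < 1)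
    (σ : Fin 2) (p₀ : GridPoint L N) :
    ∑ p₁ : GridPoint L N, (if p₁.2 - p₀.2 = 0 then (0 : ℝ) else
        (1 + (((p₁.2 - p₀.2) 0).valMinAbs.natAbs : ℝ) + (((p₁.2 - p₀.2) 1).valMinAbs.natAbs : ℝ)) ^ 2) *
      ‖kernel ℂ (effAction ℂ C (hubbardGridInteraction L N β U + hubbardGridCounterQuadratic L N β K) -
          hubbardGridCounterQuadratic L N β K) 2 (fun i => ((![p₀, p₁] i, σ), i))‖ ≤
      4 * (ρ⁻¹ ^ 2 * (Real.exp 1 * normV (GridLeg (GridPoint L N)) κ ρ Nw) *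
        (Real.exp 1 * αw * normV (GridLeg (GridPoint L N)) κ ρ Nw / κ ^ 2) /
          (1 - Real.exp 1 * αw * normV (GridLeg (GridPoint L N)) κ ρ Nw / κ ^ 2)) := by
  set ω : (Fin 2 → GridLeg (GridPoint L N)) → ℝ := fun Y => if (Y 1).1.1.2 - (Y 0).1.1.2 = 0 then (0 : ℝ) else
      (1 + ((((Y 1).1.1.2 - (Y 0).1.1.2) 0).valMinAbs.natAbs : ℝ) + ((((Y 1).1.1.2 - (Y 0).1.1.2) 1).valMinAbs.natAbs : ℝ)) ^ 2 with hω
  have hω0 : ∀ Y, 0 ≤ ω Y := fun Y => by rw [hω]; dsimp only; split_ifs <;> positivity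
  have hpair : ∀ X Y : GridLeg (GridPoint L N), ({X, Y} : Finset (GridLeg (GridPoint L N))).image gridLegPos = {gridLegPos X, gridLegPos Y} :=
    fun X Y => by rw [image_insert, image_singleton]
  have h := twoLeg_offDiag_wsum_le_of_wgridStep C β U K (isTreeWeight_wt₂ (L := L) (N := N) hβ') hκ hGB Nw hNw0
    (fun m' j w => by simpa only [Finset.image_image] using hNw m' j w) hαw (fun X => by simpa only [hpair] using hrow X)
    (fun Y => by simpa only [hpair] using hcol Y) hρ hθ ω
    (fun Y hY => by simpa only [hω] using offDiagMomentWeight_eq_zero_of_point_eq 2 Y hY) (by norm_num : (0 : ℝ) ≤ 4)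
    (fun Y => by simpa only [hω, Finset.image_image] using offDiagMomentWeight_sq_le_four_mul_wt₂ (L := L) (N := N) hβ' Y) (((p₀, σ), 0))
  refine le_trans ?_ h
  refine le_trans (le_of_eq ?_) (sum_point_string_le_sum_pinned (fun Y => ω Y * ‖kernel ℂ (effAction ℂ C
      (hubbardGridInteraction L N β U + hubbardGridCounterQuadratic L N β K) - hubbardGridCounterQuadratic L N β K) 2 Y‖)
      (fun Y => mul_nonneg (hω0 Y) (norm_nonneg _)) σ p₀)
  refine sum_congr rfl fun p₁ _ => ?_
  simp only [hω, Matrix.cons_val_zero, Matrix.cons_val_one, Matrix.cons_val_fin_one]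

/-- **THE TEMPORAL FIRST MOMENT** (`Bᵗ`, circular grid distance): with `wt₁`, `α_w`, `N_w`, `θ_w < 1` as in `twoLeg_offDiag_moment_one_sum_le`:
`Σ_{p₁} (β′/N)·circDist_N(j₀, j₁)·‖kernel₂ (W − 𝒩_{K,N}) ((p₀,σ,+),(p₁,σ,−))‖ ≤ ρ⁻²·e‖Ṽ‖_{h,wt₁}·θ_w/(1−θ_w)`. -/
theorem twoLeg_time_sum_le (C : Matrix (GridLeg (GridPoint L N)) (GridLeg (GridPoint L N)) ℂ) (β U : ℝ) (K : TrigPolyC4v)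
    {β' : ℝ} (hβ' : 0 ≤ β') {κ : ℝ} (hκ : 0 < κ) (hGB : IsGramBoundedR C κ) (Nw : ℕ → ℝ) (hNw0 : ∀ m', 0 ≤ Nw m')
    (hNw : ∀ m' (j : Fin (2 * m')) (w : GridLeg (GridPoint L N)),
      ∑ Y ∈ univ.filter (fun Y : Fin (2 * m') → GridLeg (GridPoint L N) => Y j = w),
        ‖kernel ℂ (hubbardGridInteraction L N β U + hubbardGridCounterQuadratic L N β K) (2 * m') Y‖ *
          gridLabelWt L N β' ((univ.image Y).image gridLegPos) ≤ Nw m')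
    {αw : ℝ} (hαw : 0 < αw) (hrow : ∀ X, ∑ Y, ‖C X Y‖ * gridLabelWt L N β' {gridLegPos X, gridLegPos Y} ≤ αw)
    (hcol : ∀ Y, ∑ X, ‖C X Y‖ * gridLabelWt L N β' {gridLegPos X, gridLegPos Y} ≤ αw)
    {ρ : ℝ} (hρ : 0 < ρ) (hθ : Real.exp 1 * αw * normV (GridLeg (GridPoint L N)) κ ρ Nw / κ ^ 2 < 1)
    (σ : Fin 2) (p₀ : GridPoint L N) :
    ∑ p₁ : GridPoint L N, β' / N * (circDist N p₀.1.val p₁.1.val : ℝ) *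
      ‖kernel ℂ (effAction ℂ C (hubbardGridInteraction L N β U + hubbardGridCounterQuadratic L N β K) -
          hubbardGridCounterQuadratic L N β K) 2 (fun i => ((![p₀, p₁] i, σ), i))‖ ≤
      ρ⁻¹ ^ 2 * (Real.exp 1 * normV (GridLeg (GridPoint L N)) κ ρ Nw) *
        (Real.exp 1 * αw * normV (GridLeg (GridPoint L N)) κ ρ Nw / κ ^ 2) /
          (1 - Real.exp 1 * αw * normV (GridLeg (GridPoint L N)) κ ρ Nw / κ ^ 2) := by
  set ω : (Fin 2 → GridLeg (GridPoint L N)) → ℝ := fun Y => β' / N * (circDist N (Y 0).1.1.1.val (Y 1).1.1.1.val : ℝ) with hω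
  have hω0 : ∀ Y, 0 ≤ ω Y := fun Y => by rw [hω]; exact mul_nonneg (div_nonneg hβ' (Nat.cast_nonneg _)) (Nat.cast_nonneg _)
  have hpair : ∀ X Y : GridLeg (GridPoint L N), ({X, Y} : Finset (GridLeg (GridPoint L N))).image gridLegPos = {gridLegPos X, gridLegPos Y} :=
    fun X Y => by rw [image_insert, image_singleton]
  have h := twoLeg_offDiag_wsum_le_of_wgridStep C β U K (isTreeWeight_wt₁ (L := L) (N := N) hβ') hκ hGB Nw hNw0
    (fun m' j w => by simpa only [Finset.image_image] using hNw m' j w) hαw (fun X => by simpa only [hpair] using hrow X)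
    (fun Y => by simpa only [hpair] using hcol Y) hρ hθ ω
    (fun Y hY => timeWeight_eq_zero_of_point_eq β' Y hY) zero_le_one
    (fun Y => by simpa only [hω, Finset.image_image, one_mul] using timeWeight_le_wt₁ (L := L) (N := N) β' Y) (((p₀, σ), 0))
  rw [one_mul] at h
  refine le_trans ?_ h
  refine le_trans (le_of_eq ?_) (sum_point_string_le_sum_pinned (fun Y => ω Y * ‖kernel ℂ (effAction ℂ C
      (hubbardGridInteraction L N β U + hubbardGridCounterQuadratic L N β K) - hubbardGridCounterQuadratic L N β K) 2 Y‖)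
      (fun Y => mul_nonneg (hω0 Y) (norm_nonneg _)) σ p₀)
  refine sum_congr rfl fun p₁ _ => ?_
  simp only [hω, Matrix.cons_val_zero, Matrix.cons_val_one, Matrix.cons_val_fin_one]

/-! ## §5 The plain point sum (`B₀`) in the consumers' shape (appended) -/

omit [NeZero N] in
/-- **THE PLAIN POINT SUM** (`B₀`, the `hB0` of `twoLeg_sep_momentumSizes_of_grid`): with the unweighted pinned profile of `Ṽ`, plain
row/column sums `≤ α`, `θ = eα‖Ṽ‖_h/κ² < 1`: for every spin `σ` and grid point `p₀`,
`Σ_{p₁} ‖kernel₂ (W − 𝒩_{K,N}) ((p₀,σ,+),(p₁,σ,−))‖ ≤ ρ⁻²·e‖Ṽ‖_h/(1 − θ) + (|β|/N)·coeffNorm₀ K` (`twoLeg_plain_sum_le_of_gridStep` through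
`sum_point_string_le_sum_pinned`). -/
theorem twoLeg_plain_point_sum_le (C : Matrix (GridLeg (GridPoint L N)) (GridLeg (GridPoint L N)) ℂ) (β U : ℝ) (K : TrigPolyC4v)
    {κ : ℝ} (hκ : 0 < κ) (hGB : IsGramBoundedR C κ)
    {α : ℝ} (hα : 0 < α) (hrow : ∀ X, ∑ Y, ‖C X Y‖ ≤ α) (hcol : ∀ Y, ∑ X, ‖C X Y‖ ≤ α)
    {ρ : ℝ} (hρ : 0 < ρ)
    (hθ : Real.exp 1 * α * normV (GridLeg (GridPoint L N)) κ ρ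
      (fun m' => if m' = 1 then |β| / N * K.coeffNorm 0 else if m' = 2 then |U| * |β| / N else 0) / κ ^ 2 < 1)
    (σ : Fin 2) (p₀ : GridPoint L N) :
    ∑ p₁ : GridPoint L N,
      ‖kernel ℂ (effAction ℂ C (hubbardGridInteraction L N β U + hubbardGridCounterQuadratic L N β K) -
          hubbardGridCounterQuadratic L N β K) 2 (fun i => ((![p₀, p₁] i, σ), i))‖ ≤
      ρ⁻¹ ^ 2 * (Real.exp 1 * normV (GridLeg (GridPoint L N)) κ ρ
          (fun m' => if m' = 1 then |β| / N * K.coeffNorm 0 else if m' = 2 then |U| * |β| / N else 0)) /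
        (1 - Real.exp 1 * α * normV (GridLeg (GridPoint L N)) κ ρ
          (fun m' => if m' = 1 then |β| / N * K.coeffNorm 0 else if m' = 2 then |U| * |β| / N else 0) / κ ^ 2) +
      |β| / N * K.coeffNorm 0 :=
  (sum_point_string_le_sum_pinned (fun Y => ‖kernel ℂ (effAction ℂ C (hubbardGridInteraction L N β U + hubbardGridCounterQuadratic L N β K) -
      hubbardGridCounterQuadratic L N β K) 2 Y‖) (fun _ => norm_nonneg _) σ p₀).trans
    (twoLeg_plain_sum_le_of_gridStep C β U K hκ hGB hα hrow hcol hρ hθ ((p₀, σ), 0))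

end Summit.HubbardSuperconductivity.HubbardSuperconductivity.Theorems.EngineV8

end
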